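import Literature.AlgebraicGeometry.AbelianSchemes.TorsionSectionGramUnits
import HarnessLib

/-!
# The Weil pairings of two `M`-torsion sections are the fibre values of ONE global unit of the base ([MumfordAV1970] §20:
# the `e_n`-pairing over a base is a section of `μ_n`; «`ē^L(x, y) = e_n(x, φ_L(y))`», [Milne1986AbelianVarieties] §16)

Layer `Literature/AlgebraicGeometry/AbelianSchemes`, namespace `Literature.AlgebraicGeometry.AbelianSchemes.AbelianSchemeOver`.  THEOREMS ONLY (no
definition, no named fact, no instance, no notation, no `sorry`).  Cell `hodgecm-mathlib` (D-0151), FLOOR 0, P6 «MOD» (crux hLiu418 =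
stmt-HodgeConjecture-24832, `--supports`), half A line L7, socket `stub_UNIVFAM` (★ P-3), organ O3 `stub_FLAT`, sub-organ FLAT-b(ii) «PAIRING READINGS
CONSTANT ALONG A CHART», piece **W2 «GLOBAL PAIRING UNITS»** (LA7-plan RULING 2026-09-02T02:22Z (3)–(4), route (α)).  HC_CM is proved only modulo
the printed citations until rung 0 closes; this file is count-neutral.

THE MATHEMATICS.  [MumfordAV1970] §20 pp. 183–185: the `e_n`-pairing of an abelian scheme `A_T → T` is a morphism `A_T[n] ×_T Â_T[n] → μ_{n,T}`;
for two `n`-torsion SECTIONS `a, b` of `A_T` and a polarisation `λ`, `ē^λ_n(a, b) = e_n(a, λ ∘ b)` is therefore a GLOBAL SECTION of `μ_n` over `T`,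
whose value at every geometric point `t` is the Weil pairing of the fibre ([Milne1986AbelianVarieties] §16: `ē_m^𝓛(a, a′) = ē_m(a, φ_𝓛 a′)`).  The
tree's ★ `TorsionSectionGramUnits` proves exactly this inside the proof of its head `exists_rootsOfUnity_transport_weilPairingLevel` (★
`TorsionPairing.exists_poincarePairingUnit_fun` for the units, ★ `weilPairingLevel_baseChangeTorsionPt_eq_inv` for the fibre evaluation); THIS
FILE exposes the intermediate statement the analytic consumer needs — ONE family of units `u b a ∈ Γ(T, 𝒪_T)` with `(u b a)^M = 1` whose value
at ANY geometric point `t` (any field, any `IsLambdaOfAt` witness `Θ` on the fibre `A_{t ≫ f}`) is the INVERSE Weil pairing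
`ē^Θ_M(a(t), b(t))⁻¹` — so that along a continuous family of complex points the pairing is a continuous `μ_M`-valued function (FLAT-b(ii)).

* `exists_pairingUnits_weilPairingLevel_eq_inv` — the statement above.

## References
* [MumfordAV1970] D. Mumford, *Abelian Varieties* (1970), §20 (pp. 183–185), §23 (p. 228).
* [Milne1986AbelianVarieties] J. S. Milne, *Abelian Varieties* (1986), §16 (p. 132).
-/

set_option autoImplicit false

noncomputable section

-- `Over`-morphism components and the transported group structures are compared across `def`s (as in ★ `TorsionSectionGramUnits`).
set_option backward.isDefEq.respectTransparency false

universe u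

open CategoryTheory CategoryTheory.Limits AlgebraicGeometry MonoidalCategory CartesianMonoidalCategory
open scoped MonObj

namespace Literature.AlgebraicGeometry.AbelianSchemes.AbelianSchemeOver

open Literature.AlgebraicGeometry.RelativeSpec Literature.AlgebraicGeometry.Motives
  Literature.AlgebraicGeometry.AbelianVarieties

/-- **THE WEIL PAIRINGS OF TWO `M`-TORSION SECTIONS ARE THE FIBRE VALUES OF ONE GLOBAL UNIT** ([MumfordAV1970] §20; [Milne1986AbelianVarieties]
§16): for an abelian scheme `A → S` over a reduced locally Noetherian base with a dual pair `D` satisfying the Poincaré unit hypothesis `hD` (★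
`Polarization.nonempty_unitHatSlice_iso` for a polarisation) and a homomorphism `λ : A → Â`, a base change `f : T → S` (`T` locally Noetherian,
`A_T` with commutative law) and `M ≠ 0`, there are units `u b a ∈ Γ(T, 𝒪_T)` (`a, b ∈ A_T[M](T)`) with `(u b a)^M = 1` such that at EVERY
geometric point `t : Spec Ω → T` with `M ≠ 0` in `Ω` and for EVERY witness `Θ` of `λ` on the fibre `A_{t ≫ f}` (★ `IsLambdaOfAt`):
`ē^Θ_M(a(t), b(t)) = (u b a)(t)⁻¹`.
[cite: MumfordAV1970, §20 (pp. 183–185)] [cite: Milne1986AbelianVarieties, §16 (p. 132)] -/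
theorem exists_pairingUnits_weilPairingLevel_eq_inv {S T : Scheme.{u}} [IsReduced S] [IsLocallyNoetherian S] [IsLocallyNoetherian T]
    (A : AbelianSchemeOver S) (D : A.DualPair)
    (hD : Nonempty ((Scheme.Modules.pullback (DualPair.unitHatSlice D)).obj D.P ≅ SheafOfModules.unit _))
    (lam : A.X ⟶ D.hat.X) [IsMonHom lam] (f : T ⟶ S) [IsCommMonObj (A.baseChange f).X] (M : ℕ) [NeZero M] :
    ∃ u : (A.baseChange f).torsionSections M → (A.baseChange f).torsionSections M → Γ(T, ⊤),
      (∀ a b, u b a ^ M = 1) ∧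
      ∀ {Ω : Type u} [Field Ω] (t : Spec (.of Ω) ⟶ T) (hM : (M : Ω) ≠ 0)
        (Θ : CartierDivisor (A.fibre (t ≫ f)).toAbelianVariety.X.left) (_ : A.IsLambdaOfAt (t ≫ f) D lam Θ)
        (a b : (A.baseChange f).torsionSections M),
        haveI := AbelianVariety.isDominant_toSchemeHom_zsmul_of_ne_zero (A.fibre (t ≫ f)).toAbelianVariety hM
        (A.fibre (t ≫ f)).toAbelianVariety.weilPairingLevel Θ (A.baseChangeTorsionPt M f t a) (A.baseChangeTorsionPt M f t b) =
          ((Scheme.ΓSpecIso (.of Ω)).hom (t.appTop (u b a)))⁻¹ := by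
  classical
  -- adapted from ★ `TorsionSectionGramUnits.exists_rootsOfUnity_transport_weilPairingLevel` (its first steps, verbatim)
  -- the pairing units of `A_T[M](T)` acting on `L_{c_b}` over `[M]_{A_T}`, for every `b` (★ W1b §3 with `c := c_b`)
  have hex := fun b : (A.baseChange f).torsionSections M =>
    TorsionPairing.exists_poincarePairingUnit_fun D f hD (A.torsionPointHat M f D lam b)
      (A.torsionPointHat_pow_eq_one M f D lam b) ((A.baseChange f).translationActionMulN M)
  choose e u hu using hex
  -- every unit is an `M`-th root of unity
  have huM : ∀ a b, u b a ^ M = 1 := fun a b =>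
    TorsionPairing.pairingUnit_pow_eq_one (A.baseChange f) ((A.baseChange f).translationActionMulN M) _ (e b) (u b) (hu b)
      (Subtype.ext ((A.baseChange f).torsionSections_pow M a))
  refine ⟨u, huM, fun t hM Θ hΘ a b => ?_⟩
  exact A.weilPairingLevel_baseChangeTorsionPt_eq_inv M D lam f t hM Θ hΘ b (e b) (u b) (hu b) a

end Literature.AlgebraicGeometry.AbelianSchemes.AbelianSchemeOver

end
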